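import Summits.ResolutionOfSingularities.ResolutionOfSingularities.Theorems.FrobeniusClosingSteerBranchObstructionCore
import Summits.ResolutionOfSingularities.ResolutionOfSingularities.Theorems.FrobeniusClosingSteerK7HatBranchConclusion
import Summits.ResolutionOfSingularities.ResolutionOfSingularities.Theorems.FrobeniusClosingSteerBetaPolygonCohenCoordinates
import Literature.AlgebraicGeometry.Resolution.CompleteLocalDomainNormalizationPowerSeries
import Literature.AlgebraicGeometry.Resolution.PowerSeriesRegularLocal
import Literature.AlgebraicGeometry.Resolution.AdicNoetherian
import Literature.RingTheory.MvPolynomial.EquidimensionalHilbert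
import Mathlib.RingTheory.PowerSeries.Order
import HarnessLib

/-!
# K-β7-hat W2 — `BranchObstruction` HOLDS (the heart of `FormalCentreDescent`; W4.1, OURS)

`branchObstruction_holds : K7Hat.BranchObstruction` — the crux piece W2 of res-L0-w41-idea-1's kernel decomposition of the
repaired β-slot word `FormalCentreDescent` (`K7HatWords-idea-1-g12.lean` cbdb8a4f311bfcb9 l.223 = tree
`…Theorems.SwitchingDichotomy.K7Hat.BranchObstruction`, res-D-pv-035's p555432; memo `CANONICAL-CLEANING-g10.md`
§12.3 (3)+(4), §12.4; res-L0-w41-plan-1 RULING 237(b)). With W1 `BranchTransfer`, W3 `BranchConclusion` (p556662)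
and F0 `HatFrame` (p556572) it assembles to `formalCentreDescent_of` (tree, sorry-free).

Proof = transport to hat coordinates + the algebraic heart `BranchCore.false_of_parametrisedBranch`
(`…SteerBranchObstructionCore`): (1) S0 (`K7HatBranchConclusion.hatCoordinates_core`): `T` regular of dimension 4,
`𝔪_T = (ιx, ιy, z′, w′)`, `P₁ = (ιx, z′, w′)` prime with `dim T⧸P₁ = 1`, `ι` injective; (2) the Cohen frame
`e₄ : T ≃ κT⟦X₀..X₃⟧` on that r.s.o.p. (`CanonicalCleaning.exists_ringEquiv_mvPowerSeries_four`, char 2); (3) if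
`𝔓 ≠ P₁` then `X₂, X₃` are not both in `e₄(𝔓)` (else `e₄(P₁) ⊆ e₄(𝔓)`, both prime of quotient dimension 1, hence equal —
`Literature.RingTheory.MvPolynomial.eq_of_le_of_ringKrullDim_quotient_eq`); (4) the BRANCH PARAMETRISATION
`γ : κT⟦X⟧ → L⟦τ⟧` of `e₄(𝔓)` (`exists_branch_parametrisation`, from res-D-lit-1's
`exists_branchParametrization_of_complete`, p554060: the normalisation of the complete one-dimensional local domain
`κT⟦X⟧ ⧸ e₄(𝔓)` is a power series ring) with kernel `e₄(𝔓)`, all variables in `(τ)`, `γ X₀ = 0`; (5) the common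
`τ`-order `m ≥ 1` of `γ X₂, γ X₃` and the tangent vector `(ζ₁(0), ω₁(0)) ≠ 0` (`exists_common_order`); (6) transport
of the normal form `F − g² − Ψ(z, w) ∈ 𝔪^{d+1}` (with `e₄(ιz) = X₂ + X₀A + X₁B`, `e₄(ιw) = X₃ + X₀A′ + X₁B′` from
`z′ ≡ ιz`, `w′ ≡ ιw mod (x, y)T`), of the formal-centre datum `ιF + q² ∈ P₁^d` and of the square-descent datum
`u²F + r² ∈ Q₀^d`, `u ∉ Q₀`; (7) `false_of_parametrisedBranch`. Everything here is OURS (the run's own bookkeeping),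
AI-written and AI-checked only — weaker than expert review; nothing is a statement of [Hironaka2017]. -/

set_option linter.dupNamespace false
set_option autoImplicit false

namespace Summit.ResolutionOfSingularities.ResolutionOfSingularities.Theorems.SwitchingDichotomy.BranchFinal

open IsLocalRing
open MvPowerSeries (X C coeff constantCoeff)

/-! ## §1 Common order of two power series along the branch -/

/-- A non-zero `f ∈ L⟦τ⟧` is `τ^n · ζ` with `ζ(0) ≠ 0`, `n` its order. OURS. -/
theorem exists_eq_X_pow_mul_of_ne_zero {L : Type*} [Field L] {f : PowerSeries L} (hf : f ≠ 0) :
    ∃ ζ : PowerSeries L, f = PowerSeries.X ^ f.order.toNat * ζ ∧ PowerSeries.constantCoeff ζ ≠ 0 := by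
  set n := f.order.toNat with hn
  have hc : PowerSeries.coeff n f ≠ 0 := PowerSeries.coeff_order hf
  obtain ⟨ζ, hζ⟩ := PowerSeries.X_pow_order_dvd (φ := f)
  rw [← hn] at hζ
  refine ⟨ζ, hζ, fun h0 => ?_⟩
  rw [hζ, PowerSeries.coeff_X_pow_mul', if_pos le_rfl, Nat.sub_self, PowerSeries.coeff_zero_eq_constantCoeff,
    h0] at hc
  exact hc rfl

/-- **Common order**: two elements of `(τ) ⊆ L⟦τ⟧`, not both zero, are `τ^m ζ₁`, `τ^m ω₁` with `m ≥ 1` and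
`(ζ₁(0), ω₁(0)) ≠ 0`. OURS. -/
theorem exists_common_order {L : Type*} [Field L] (f g : PowerSeries L)
    (hf : PowerSeries.X ∣ f) (hg : PowerSeries.X ∣ g) (h : f ≠ 0 ∨ g ≠ 0) :
    ∃ (m : ℕ) (ζ ω : PowerSeries L), 1 ≤ m ∧ f = PowerSeries.X ^ m * ζ ∧ g = PowerSeries.X ^ m * ω ∧
      (PowerSeries.constantCoeff ζ ≠ 0 ∨ PowerSeries.constantCoeff ω ≠ 0) := by
  -- orders are `≥ 1`
  have hord : ∀ {p : PowerSeries L}, PowerSeries.X ∣ p → p ≠ 0 → 1 ≤ p.order.toNat := by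
    intro p hp hp0
    by_contra hlt
    have h0 : p.order.toNat = 0 := by omega
    have hc : PowerSeries.coeff p.order.toNat p ≠ 0 := PowerSeries.coeff_order hp0
    rw [h0, PowerSeries.coeff_zero_eq_constantCoeff] at hc
    exact hc ((PowerSeries.X_dvd_iff).mp hp)
  by_cases hf0 : f = 0
  · have hg0 : g ≠ 0 := h.resolve_left (not_not.mpr hf0)
    obtain ⟨ω, hω, hω0⟩ := exists_eq_X_pow_mul_of_ne_zero hg0
    exact ⟨g.order.toNat, 0, ω, hord hg hg0, by rw [hf0, mul_zero], hω, Or.inr hω0⟩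
  by_cases hg0 : g = 0
  · obtain ⟨ζ, hζ, hζ0⟩ := exists_eq_X_pow_mul_of_ne_zero hf0
    exact ⟨f.order.toNat, ζ, 0, hord hf hf0, hζ, by rw [hg0, mul_zero], Or.inl hζ0⟩
  obtain ⟨ζ, hζ, hζ0⟩ := exists_eq_X_pow_mul_of_ne_zero hf0
  obtain ⟨ω, hω, hω0⟩ := exists_eq_X_pow_mul_of_ne_zero hg0
  by_cases hle : f.order.toNat ≤ g.order.toNat
  · refine ⟨f.order.toNat, ζ, PowerSeries.X ^ (g.order.toNat - f.order.toNat) * ω, hord hf hf0, hζ, ?_, Or.inl hζ0⟩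
    rw [← mul_assoc, ← pow_add, Nat.add_sub_cancel' hle]; exact hω
  · refine ⟨g.order.toNat, PowerSeries.X ^ (f.order.toNat - g.order.toNat) * ζ, ω, hord hg hg0, ?_, hω, Or.inr hω0⟩
    rw [← mul_assoc, ← pow_add, Nat.add_sub_cancel' (by omega)]; exact hζ

/-! ## §2 The word W2 -/

open Literature.AlgebraicGeometry.Resolution
open Summit.ResolutionOfSingularities.ResolutionOfSingularities.Theorems.SwitchingDichotomy.Words
open Summit.ResolutionOfSingularities.ResolutionOfSingularities.Theorems.SwitchingDichotomy.K7Hat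
open Summit.ResolutionOfSingularities.ResolutionOfSingularities.Theorems.SwitchingDichotomy.K7HatBranchConclusion
  (hatCoordinates_core)
open Summit.ResolutionOfSingularities.ResolutionOfSingularities.Theorems.SwitchingDichotomy.CanonicalCleaning
  (exists_ringEquiv_mvPowerSeries_four)
open Summit.ResolutionOfSingularities.ResolutionOfSingularities.Theorems.SwitchingDichotomy.BranchCore
  (false_of_parametrisedBranch)

/-- In a regular local ring of dimension `n` the maximal ideal needs exactly `n` generators. OURS packaging. -/
theorem spanFinrank_eq_of_dim {S : Type*} [CommRing S] [IsRegularLocalRing S] {n : ℕ}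
    (hn : ringKrullDim S = n) : (maximalIdeal S).spanFinrank = n := by
  have h := IsRegularLocalRing.spanFinrank_maximalIdeal (R := S)
  rw [hn] at h
  exact_mod_cast h

/-- **A prime of `κ⟦X₀..X₃⟧` with one-dimensional quotient is PARAMETRISED**: there is a ring homomorphism
`γ : κ⟦X⟧ → L⟦τ⟧` with kernel exactly `𝒫` sending every variable into `(τ)` (the normalisation of the complete
one-dimensional local domain `κ⟦X⟧ ⧸ 𝒫` is `L⟦τ⟧`, res-D-lit-1's `exists_branchParametrization_of_complete`). OURS. -/
theorem exists_branch_parametrisation (κT : Type) [Field κT] (PP : Ideal (MvPowerSeries (Fin 4) κT))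
    [hPP : PP.IsPrime] (hdim : ringKrullDim ((MvPowerSeries (Fin 4) κT) ⧸ PP) = (1 : ℕ)) :
    ∃ (L : Type) (_ : Field L) (γ : MvPowerSeries (Fin 4) κT →+* PowerSeries L),
      (∀ f, γ f = 0 ↔ f ∈ PP) ∧ ∀ sIdx : Fin 4, PowerSeries.X ∣ γ (X sIdx) := by
  classical
  haveI : IsNoetherianRing (MvPowerSeries (Fin 4) κT) := isNoetherianRing_mvPowerSeries κT (Fin 4)
  haveI : IsAdicComplete (maximalIdeal (MvPowerSeries (Fin 4) κT)) (MvPowerSeries (Fin 4) κT) := by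
    rw [maximalIdeal_mvPowerSeries_eq_span κT (Fin 4)]; infer_instance
  haveI : IsLocalRing ((MvPowerSeries (Fin 4) κT) ⧸ PP) := .of_surjective' (Ideal.Quotient.mk PP) Ideal.Quotient.mk_surjective
  haveI : IsAdicComplete (maximalIdeal ((MvPowerSeries (Fin 4) κT) ⧸ PP)) ((MvPowerSeries (Fin 4) κT) ⧸ PP) :=
    isAdicComplete_maximalIdeal_of_module_finite (MvPowerSeries (Fin 4) κT) ((MvPowerSeries (Fin 4) κT) ⧸ PP)
  set φ0 : κT →+* (MvPowerSeries (Fin 4) κT) ⧸ PP := (Ideal.Quotient.mk PP).comp (MvPowerSeries.C) with hφ0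
  have hk₀ : IsField φ0.range :=
    MulEquiv.isField (Field.toIsField κT)
      (RingEquiv.ofBijective φ0.rangeRestrict ⟨fun a b h => φ0.injective (Subtype.ext_iff.mp h),
        φ0.rangeRestrict_surjective⟩).symm.toMulEquiv
  obtain ⟨eW, -, -, hinj, hlocal, -⟩ :=
    exists_branchParametrization_of_complete ((MvPowerSeries (Fin 4) κT) ⧸ PP) φ0.range hk₀ hdim
  set D := (MvPowerSeries (Fin 4) κT) ⧸ PP with hD
  haveI := isDiscreteValuationRing_integralClosure_of_complete D hdim
  set W := integralClosure D (FractionRing D) with hW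
  set L := ResidueField W with hL
  set τD : D →+* PowerSeries L := eW.symm.toRingHom.comp (algebraMap D W) with hτD
  set γ : (MvPowerSeries (Fin 4) κT) →+* PowerSeries L := τD.comp (Ideal.Quotient.mk PP) with hγ
  have hPγ : ∀ f ∈ PP, γ f = 0 := fun f hf => by
    rw [hγ, RingHom.comp_apply, Ideal.Quotient.eq_zero_iff_mem.mpr hf, map_zero]
  have hγker : ∀ f, γ f = 0 → f ∈ PP := fun f hf => by
    rw [← Ideal.Quotient.eq_zero_iff_mem]
    apply hinj
    rw [map_zero]; exact hf
  haveI : IsLocalHom γ := by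
    haveI : IsLocalHom (Ideal.Quotient.mk PP) := IsLocalHom.of_surjective _ Ideal.Quotient.mk_surjective
    haveI := hlocal
    exact RingHom.isLocalHom_comp _ _
  have hγX : ∀ sIdx : Fin 4, PowerSeries.X ∣ γ (X sIdx) := by
    intro sIdx
    rw [PowerSeries.X_dvd_iff]
    by_contra hne0
    have hunit : IsUnit (γ (X sIdx)) := PowerSeries.isUnit_iff_constantCoeff.mpr (isUnit_iff_ne_zero.mpr hne0)
    have hXunit : IsUnit (X sIdx : (MvPowerSeries (Fin 4) κT)) := isUnit_of_map_unit γ _ hunit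
    exact (IsLocalRing.mem_maximalIdeal _ |>.mp (X_mem_maximalIdeal κT (Fin 4) sIdx)) hXunit
  refine ⟨L, inferInstance, γ, fun f => ⟨hγker f, hPγ f⟩, hγX⟩

/-- **W2 · `BranchObstruction` HOLDS** (the heart of K-β7-hat; memo §12.3 (3)+(4), §12.4). OURS. -/
theorem branchObstruction_holds : BranchObstruction := by
  intro K _ _ R s i hloc hs T _ _ ι e x y z w g Ψ d z' w' q u r hreg hdim hhat he hspan h2d hodd hhom hnf han hz hw
    hsq hu hur P hP hPQ hPdim
  classical
  -- ### S0: the hat is regular of dimension 4 with r.s.o.p. `(ι x, ι y, z′, w′)`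
  obtain ⟨hff, hTreg, hTdim, hmaxT, -, -, hP₁prime, -, hregQ, hdimQ⟩ :=
    hatCoordinates_core ι e x y z w z' w' hreg hdim hhat.2.2.1 he hspan hz hw
  set P₁ : Ideal T := Ideal.span {ι x, z', w'} with hP₁def
  by_contra hne
  haveI := hTreg
  haveI : IsNoetherianRing T := hhat.1
  haveI : IsAdicComplete (maximalIdeal T) T := hhat.2.1
  haveI := hregQ
  haveI := hP₁prime
  obtain ⟨hPmin, -⟩ := hP
  haveI hPprime : P.IsPrime := hPmin.1
  have hP₁dim : ringKrullDim (T ⧸ P₁) = (1 : ℕ) := by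
    obtain ⟨n, hn⟩ := exists_nat_cast_eq_ringKrullDim (R := T ⧸ P₁)
    rw [hn] at hdimQ ⊢
    have h' : ((n + 3 : ℕ) : WithBot ℕ∞) = ((4 : ℕ) : WithBot ℕ∞) := by push_cast; exact hdimQ
    have e1 : n + 3 = 4 := by exact_mod_cast h'
    have e2 : n = 1 := by omega
    rw [e2]
  -- `ι` is injective (faithful flatness on ideals), so `T` has characteristic 2
  have hιinj : Function.Injective ι := by
    rw [injective_iff_map_eq_zero]
    intro a ha
    have : a ∈ ((⊥ : Ideal (R i)).map ι).comap ι := by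
      rw [Ideal.mem_comap, ha]; exact Ideal.zero_mem _
    rwa [hff ⊥, Ideal.mem_bot] at this
  haveI : CharP T 2 := charP_of_injective_ringHom hιinj 2
  haveI : Fact (Nat.Prime 2) := ⟨Nat.prime_two⟩
  -- ### Cohen frame of the hat on `(ι x, ι y, z′, w′)`
  set κT := ResidueField T with hκT
  obtain ⟨e₄, hex, hey, hez, hew, hec⟩ :=
    exists_ringEquiv_mvPowerSeries_four 2 T (spanFinrank_eq_of_dim hTdim) (ι x) (ι y) z' w' hmaxT
  haveI : CharP κT 2 := by
    refine CharTwo.of_one_ne_zero_of_two_eq_zero one_ne_zero ?_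
    rw [← map_ofNat (residue T) 2, CharTwo.two_eq_zero, map_zero]
  haveI : IsNoetherianRing (MvPowerSeries (Fin 4) κT) := isNoetherianRing_mvPowerSeries κT (Fin 4)
  haveI : IsAdicComplete (maximalIdeal (MvPowerSeries (Fin 4) κT)) (MvPowerSeries (Fin 4) κT) := by
    rw [maximalIdeal_mvPowerSeries_eq_span κT (Fin 4)]; infer_instance
  -- ### the two primes in hat coordinates
  set PP : Ideal (MvPowerSeries (Fin 4) κT) := P.map (e₄ : T →+* (MvPowerSeries (Fin 4) κT)) with hPPdef
  set PP1 : Ideal (MvPowerSeries (Fin 4) κT) := P₁.map (e₄ : T →+* (MvPowerSeries (Fin 4) κT)) with hPP1def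
  haveI hPPprime : PP.IsPrime := Ideal.map_isPrime_of_equiv e₄
  haveI hPP1prime : PP1.IsPrime := Ideal.map_isPrime_of_equiv e₄
  have hPP1span : PP1 = Ideal.span {(X 0 : (MvPowerSeries (Fin 4) κT)), X 2, X 3} := by
    rw [hPP1def, hP₁def, Ideal.map_span]
    congr 1
    ext f
    simp only [Set.mem_image, Set.mem_insert_iff, Set.mem_singleton_iff]
    constructor
    · rintro ⟨t, (rfl | rfl | rfl), rfl⟩
      · exact Or.inl (by exact_mod_cast hex)
      · exact Or.inr (Or.inl (by exact_mod_cast hez))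
      · exact Or.inr (Or.inr (by exact_mod_cast hew))
    · rintro (rfl | rfl | rfl)
      · exact ⟨ι x, Or.inl rfl, by exact_mod_cast hex⟩
      · exact ⟨z', Or.inr (Or.inl rfl), by exact_mod_cast hez⟩
      · exact ⟨w', Or.inr (Or.inr rfl), by exact_mod_cast hew⟩
  have hdimPP : ringKrullDim ((MvPowerSeries (Fin 4) κT) ⧸ PP) = (1 : ℕ) := by
    rw [Nat.cast_one, ← hPdim]; exact (ringKrullDim_eq_of_ringEquiv (Ideal.quotientEquiv P PP e₄ rfl)).symm
  have hdimPP1 : ringKrullDim ((MvPowerSeries (Fin 4) κT) ⧸ PP1) = (1 : ℕ) := by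
    rw [← hP₁dim]; exact (ringKrullDim_eq_of_ringEquiv (Ideal.quotientEquiv P₁ PP1 e₄ rfl)).symm
  have hne' : PP ≠ PP1 := by
    intro h
    apply hne
    have h1 : P = (P.map (e₄ : T →+* (MvPowerSeries (Fin 4) κT))).comap (e₄ : T →+* (MvPowerSeries (Fin 4) κT)) :=
      (Ideal.comap_map_of_bijective _ e₄.bijective).symm
    have h2 : P₁ = (P₁.map (e₄ : T →+* (MvPowerSeries (Fin 4) κT))).comap (e₄ : T →+* (MvPowerSeries (Fin 4) κT)) :=
      (Ideal.comap_map_of_bijective _ e₄.bijective).symm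
    rw [h1, h2, ← hPPdef, ← hPP1def, h]
  -- `ι x ∈ P` (as `x ∈ Q₀ = P ∩ R`), so `X₀ ∈ PP`
  have hxP : ι x ∈ P := by
    have : x ∈ P.comap ι := by
      rw [hPQ, Ideal.mem_comap]; exact Ideal.subset_span (by simp)
    exact Ideal.mem_comap.mp this
  have hX0 : (X 0 : (MvPowerSeries (Fin 4) κT)) ∈ PP := by
    have := Ideal.mem_map_of_mem (e₄ : T →+* (MvPowerSeries (Fin 4) κT)) hxP
    rwa [show ((e₄ : T →+* (MvPowerSeries (Fin 4) κT))) (ι x) = X 0 from hex] at this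
  -- not both `X₂, X₃ ∈ PP` (else `PP ⊇ PP1`, equal by dimension)
  have hnotboth : ¬ ((X 2 : (MvPowerSeries (Fin 4) κT)) ∈ PP ∧ (X 3 : (MvPowerSeries (Fin 4) κT)) ∈ PP) := by
    rintro ⟨h2, h3⟩
    apply hne'
    symm
    refine Literature.RingTheory.MvPolynomial.eq_of_le_of_ringKrullDim_quotient_eq ?_ hdimPP1 hdimPP
    rw [hPP1span, Ideal.span_le]
    rintro f (rfl | rfl | rfl)
    exacts [hX0, h2, h3]
  -- ### a second branch is parametrised
  obtain ⟨L, instL, γ, hγker', hγX⟩ := exists_branch_parametrisation κT PP hdimPP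
  letI := instL
  have hPγ : ∀ f ∈ PP, γ f = 0 := fun f hf => (hγker' f).mpr hf
  have hγker : ∀ f, γ f = 0 → f ∈ PP := fun f hf => (hγker' f).mp hf
  -- ### the branch's tangent: common `τ`-order of `γ X₂, γ X₃`
  have h0γ : γ (X 0) = 0 := hPγ _ hX0
  have hnot0 : γ (X 2) ≠ 0 ∨ γ (X 3) ≠ 0 := by
    by_contra hboth
    push Not at hboth
    exact hnotboth ⟨hγker _ hboth.1, hγker _ hboth.2⟩
  obtain ⟨m, ζ₁, ω₁, hm, hγ2, hγ3, ht⟩ := exists_common_order (γ (X 2)) (γ (X 3)) (hγX 2) (hγX 3) hnot0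
  -- ### the residue fields and the cone
  set κR := ResidueField (R i) with hκR
  haveI : CharP (R i) 2 := inferInstance
  haveI : CharP κR 2 := by
    refine CharTwo.of_one_ne_zero_of_two_eq_zero one_ne_zero ?_
    rw [← map_ofNat (residue (R i)) 2, CharTwo.two_eq_zero, map_zero]
  haveI hιloc : IsLocalHom ι := by
    refine ⟨fun a ha => ?_⟩
    by_contra hna
    have hmem : a ∈ maximalIdeal (R i) := (IsLocalRing.mem_maximalIdeal _).mpr hna
    have : ι a ∈ maximalIdeal T := by
      rw [← hhat.2.2.1]; exact Ideal.mem_map_of_mem ι hmem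
    exact (IsLocalRing.mem_maximalIdeal _ |>.mp this) ha
  set ψ : κR →+* κT := IsLocalRing.ResidueField.map ι with hψ
  set Ψb : MvPolynomial (Fin 2) κR := MvPolynomial.map (residue (R i)) Ψ with hΨb
  have hΨbhom : Ψb.IsHomogeneous d := hhom.map _
  -- ### the data in hat coordinates
  set E : T →+* (MvPowerSeries (Fin 4) κT) := (e₄ : T →+* (MvPowerSeries (Fin 4) κT)) with hE
  have hEz : E z' = X 2 := hez
  have hEw : E w' = X 3 := hew
  have hEx : E (ι x) = X 0 := hex
  have hEy : E (ι y) = X 1 := hey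
  -- linear forms: `E (ι z) = X₂ + X₀ A + X₁ B`, `E (ι w) = X₃ + X₀ A′ + X₁ B′`
  have hspanxy : (Ideal.span {x, y}).map ι = Ideal.span {ι x, ι y} := by
    rw [Ideal.map_span, Set.image_pair]
  have hlin : ∀ {v' : T} {v : R i}, v' - ι v ∈ (Ideal.span {x, y}).map ι →
      ∃ Aa Bb : (MvPowerSeries (Fin 4) κT), E (ι v) = E v' + X 0 * Aa + X 1 * Bb := by
    intro v' v hv
    rw [hspanxy] at hv
    have hv' : E (v' - ι v) ∈ Ideal.span {(X 0 : (MvPowerSeries (Fin 4) κT)), X 1} := by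
      have := Ideal.mem_map_of_mem E hv
      rw [Ideal.map_span, Set.image_pair, hEx, hEy] at this
      exact this
    obtain ⟨a, b, hab⟩ := Ideal.mem_span_pair.mp hv'
    refine ⟨-a, -b, ?_⟩
    rw [map_sub] at hab
    linear_combination hab
  obtain ⟨A, B, hLz⟩ := hlin hz
  obtain ⟨A', B', hLw⟩ := hlin hw
  rw [hEz] at hLz
  rw [hEw] at hLw
  set F₄ : (MvPowerSeries (Fin 4) κT) := E (ι ⟨s i ^ 2, hs⟩) with hF₄
  set Qg : (MvPowerSeries (Fin 4) κT) := E (ι g) with hQg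
  set Q' : (MvPowerSeries (Fin 4) κT) := E q with hQ'
  set U : (MvPowerSeries (Fin 4) κT) := E (ι u) with hU
  set Rr : (MvPowerSeries (Fin 4) κT) := E (ι r) with hRr
  set Cν : (Fin 2 →₀ ℕ) → (MvPowerSeries (Fin 4) κT) := fun ν => E (ι (MvPolynomial.coeff ν Ψ)) with hCν
  set Sm : (MvPowerSeries (Fin 4) κT) := ∑ ν ∈ Ψ.support, Cν ν * ((X 2 + X 0 * A + X 1 * B) ^ (ν 0) * (X 3 + X 0 * A' + X 1 * B') ^ (ν 1))
    with hSm
  have hFnf : F₄ = Qg ^ 2 + Sm + (F₄ - Qg ^ 2 - Sm) := by ring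
  -- the sum is the image of `Ψ(z, w)`
  have hSm_eq : Sm = E (ι (MvPolynomial.eval ![z, w] Ψ)) := by
    rw [MvPolynomial.eval_eq', map_sum, map_sum, hSm]
    refine Finset.sum_congr rfl fun ν _ => ?_
    rw [Fin.prod_univ_two, map_mul, map_mul, map_mul, map_mul, map_pow, map_pow, map_pow, map_pow]
    simp only [Matrix.cons_val_zero, Matrix.cons_val_one, hCν, hLz, hLw]
  -- `E` maps `𝔪_T` onto `𝔪`
  have hEmax : (maximalIdeal T).map E = maximalIdeal (MvPowerSeries (Fin 4) κT) := by
    apply le_antisymm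
    · rw [Ideal.map_le_iff_le_comap]
      intro a ha
      rw [Ideal.mem_comap, IsLocalRing.mem_maximalIdeal, mem_nonunits_iff]
      intro hu'
      exact (IsLocalRing.mem_maximalIdeal _ |>.mp ha) ((isUnit_map_iff e₄ a).mp hu')
    · intro b hb
      have hb' : e₄.symm b ∈ maximalIdeal T := by
        rw [IsLocalRing.mem_maximalIdeal, mem_nonunits_iff]
        intro hu'
        apply (IsLocalRing.mem_maximalIdeal _ |>.mp hb)
        have := (isUnit_map_iff e₄ (e₄.symm b)).mpr hu'
        rwa [RingEquiv.apply_symm_apply] at this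
      have := Ideal.mem_map_of_mem E hb'
      rwa [hE, RingEquiv.coe_toRingHom, RingEquiv.apply_symm_apply] at this
  -- `M := F₄ − Q² − Sm ∈ 𝔪^{d+1}`
  have hMmem : F₄ - Qg ^ 2 - Sm ∈ maximalIdeal (MvPowerSeries (Fin 4) κT) ^ (d + 1) := by
    have h1 : ι (⟨s i ^ 2, hs⟩ - g ^ 2 - MvPolynomial.eval ![z, w] Ψ) ∈ maximalIdeal T ^ (d + 1) := by
      have := Ideal.mem_map_of_mem ι hnf
      rwa [Ideal.map_pow, hhat.2.2.1] at this
    have h2 : E (ι (⟨s i ^ 2, hs⟩ - g ^ 2 - MvPolynomial.eval ![z, w] Ψ)) ∈ maximalIdeal (MvPowerSeries (Fin 4) κT) ^ (d + 1) := by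
      have := Ideal.mem_map_of_mem E h1
      rwa [Ideal.map_pow, hEmax] at this
    have hMeq : F₄ - Qg ^ 2 - Sm = E (ι (⟨s i ^ 2, hs⟩ - g ^ 2 - MvPolynomial.eval ![z, w] Ψ)) := by
      rw [hSm_eq, map_sub, map_sub, map_sub, map_sub, map_pow, map_pow]
    rw [hMeq]; exact h2
  -- ### the remaining data
  have hP1' : F₄ + Q' ^ 2 ∈ Ideal.span {(X 0 : (MvPowerSeries (Fin 4) κT)), X 2, X 3} ^ d := by
    have h1 := Ideal.mem_map_of_mem E hsq
    rw [Ideal.map_pow, map_add, map_pow] at h1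
    have h2 : Ideal.map E P₁ = PP1 := by rw [hPP1def, hE]
    rw [h2, hPP1span] at h1
    exact h1
  have hQ₀leP : (P₁.comap ι).map ι ≤ P := by
    rw [← hPQ]; exact Ideal.map_comap_le
  have hE' : U ^ 2 * F₄ + Rr ^ 2 ∈ PP ^ d := by
    have h1 : ι (u ^ 2 * ⟨s i ^ 2, hs⟩ + r ^ 2) ∈ P ^ d := by
      have := Ideal.mem_map_of_mem ι hur
      rw [Ideal.map_pow] at this
      exact Ideal.pow_right_mono hQ₀leP d this
    have h2 := Ideal.mem_map_of_mem E h1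
    rw [Ideal.map_pow, map_add, map_mul, map_pow, map_pow, map_add, map_mul, map_pow, map_pow] at h2
    have h3 : Ideal.map E P = PP := by rw [hPPdef, hE]
    rw [h3] at h2
    exact h2
  have hU' : γ U ≠ 0 := by
    intro h0
    apply hu
    have hUP : U ∈ PP := hγker _ h0
    rw [hU, hPPdef] at hUP
    have h2 : (P.map (e₄ : T →+* (MvPowerSeries (Fin 4) κT))).comap (e₄ : T →+* (MvPowerSeries (Fin 4) κT)) = P :=
      Ideal.comap_map_of_bijective _ e₄.bijective
    have : ι u ∈ (P.map (e₄ : T →+* (MvPowerSeries (Fin 4) κT))).comap (e₄ : T →+* (MvPowerSeries (Fin 4) κT)) := by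
      rw [Ideal.mem_comap]; exact hUP
    rw [h2] at this
    rw [← hPQ, Ideal.mem_comap]; exact this
  have hSupp : Ψb.support ⊆ Ψ.support := MvPolynomial.support_map_subset _ _
  have hS : ∀ ν ∈ Ψ.support, ν 0 + ν 1 = d := by
    intro ν hν
    have h := hhom (MvPolynomial.mem_support_iff.mp hν)
    simpa [Finsupp.weight_apply, Finsupp.sum_fintype, Fin.sum_univ_two] using h
  have hC : ∀ ν ∈ Ψ.support, constantCoeff (Cν ν) = ψ (MvPolynomial.coeff ν Ψb) := by
    intro ν _
    rw [hCν]
    show constantCoeff (e₄ (ι (MvPolynomial.coeff ν Ψ))) = ψ (MvPolynomial.coeff ν Ψb)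
    rw [hec, hΨb, MvPolynomial.coeff_map, hψ, IsLocalRing.ResidueField.map_residue]
  -- ### contradiction
  exact false_of_parametrisedBranch ψ γ hodd h2d Ψb F₄ Qg (F₄ - Qg ^ 2 - Sm) A B A' B' Ψ.support Cν
    hSupp hS hC hMmem hFnf PP hPγ h0γ (hγX 1) ζ₁ ω₁ hm hγ2 hγ3 ht hΨbhom han Q' U Rr hP1' hU' hE'
end Summit.ResolutionOfSingularities.ResolutionOfSingularities.Theorems.SwitchingDichotomy.BranchFinal
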